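import Summits.HodgeConjecture.HodgeConjecture.Theses.KugaSatakeSaturation

/-!
# Route KugaSatakeSaturation — `TargetGlue` (glue item stmt-HodgeConjecture-14263)

`TargetGlue := Saturation → KSDescent → Transfer → Target` is pure logic over the route file: the
support `Transfer` is the route's `Target` with the two Kuga–Satake data (for `S` and for `S'`)
un-bundled into universally quantified variables and with two extra hypotheses — the saturation
statement for the first datum (an instance of the crux `Saturation`) and Kuga–Satake descent between
the two weight-two Hodge structures (an instance of the support `KSDescent`).  Destructuring the two
existentials of `Target` and feeding those instances proves `TargetGlue` (the assembly item
`Assembly := Saturation → KSDescent → Transfer → SectorComplement → HodgeConjecture` is then the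
deciding theorem `closes` with its `TargetGlue` hypothesis discharged — companion file
`KugaSatakeSaturationAssembly`).  No other import, no named-fact hypothesis, no sorry.
-/

-- `Summit.HodgeConjecture.HodgeConjecture.Theorems` is the mandated namespace (single-problem
-- summit: Problem = Summit), which `linter.dupNamespace` flags on every declaration; the lakefile
-- turns the linter off tree-wide (weak option), restated here so stand-alone elaboration is
-- warning-free too.
set_option linter.dupNamespace false

namespace Summit.HodgeConjecture.HodgeConjecture.Theorems

open Summit.HodgeConjecture.HodgeConjecture.Theses.KugaSatakeSaturation in
/-- **Item stmt-HodgeConjecture-14263 (`TargetGlue`), route `KugaSatakeSaturation`**: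
`Saturation → KSDescent → Transfer → Target` — destructure the two Kuga–Satake data granted by the
hypotheses of `Target`, instantiate `Saturation` at the first and `KSDescent` at the pair, and apply
`Transfer`.  Pure logic; the type is the route decl
`Summit.HodgeConjecture.HodgeConjecture.Theses.KugaSatakeSaturation.TargetGlue`. -/
theorem kugaSatakeSaturation_targetGlue_proof : TargetGlue := by
  intro hSat hKS hTr B hB S S' hS hS' h1 h2 hHC hHC' hD hD' φ
  obtain ⟨T, _, _, _, H, P, j, hT, hj, g, K, hK, e, j₁, hjg, hm, O, hO⟩ := hD
  obtain ⟨T', _, _, _, H', P', j', hT', hj', g', K', hK', e', j₁', hjg', hm', O', hO'⟩ := hD'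
  exact hTr B hB S S' hS hS' h1 h2 hHC hHC' T H P j hT hj g K hK e j₁ hjg hm O hO T' H' P' j' hT'
    hj' g' K' hK' e' j₁' hjg' hm' O' hO' (hSat T H P hT.1 hT.2.1 hT.2.2)
    (hKS T T' H H' P P' hT.1 hT.2.1 hT.2.2) φ

end Summit.HodgeConjecture.HodgeConjecture.Theorems
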